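import Summits.ResolutionOfSingularities.ResolutionOfSingularities.Theorems.HilbertSamuelEliminationSigmaMaxModificationsCorridor3CPFramePropagationPoint
import Summits.ResolutionOfSingularities.ResolutionOfSingularities.Theorems.HilbertSamuelEliminationSigmaMaxModificationsCorridor3CPFramePropagationChartAlong
import HarnessLib

/-!
# [OURS · L1 W4.2] D18 (i) for centres of ANY dimension through `x_n`: a CP frame ADAPTED to the centre (`C_{x_n}·B = (z̄, x)`) and
# EQUIMULTIPLE along it (`coeff_i h ∈ (z)^{m−i}`) PROPAGATES along the blow-up of `C` to every near point over `x_n` — with the same degree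
# `m` and `δ ≥ 1` at the new point
# (cell res-hironaka, LADDER-RESOLUTION rung L; slot W4.2, crux chain w42 `SigmaMaxModificationsCorridor3` stmt-ResolutionOfSingularities-19249;
# `--supports stmt-ResolutionOfSingularities-19249 --as helper`; hand res-D-brk-3 (gen 6), D18 G6 (c) = the assembly of G6 (a) rev 2 of
# `…CPFrameChartRegular`, G6 (b) `…CPFramePropagationChartAlong`, G5 (ii-c)/(ii-d))

SCHEME-SIDE ASSEMBLY (universe `0`), 0 `def`s, every declaration PROVED; OURS bookkeeping; NOT a statement of Hironaka's manuscript [Hironaka2017]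
nor of [CossartJannsenSaito2020]/[CossartPiltant2019]. AI-written, weaker than expert review.

* **`IsCPFrame.exists_isCPFrame_blowup_of_map_stalkIdeal_eq`** — EXPLICIT STEP FORM. At a stage `s` reached by canonical near steps from a
  maximal origin (functional admissible oracle), let `(C, P')` be a canonical step at `s`, `x'` a closed point of `Bl_C` over `x_n` in the
  Hilbert–Samuel stratum (so `s → s' := (Bl_C, …, x')` is a canonical near step and res-type-064's `hilbertFun_stalk_eq_of_canonicalNearStep` /
  `ringKrullDim_stalk_eq_of_canonicalNearStep` apply). Let `(R, u, h, φ)` be a CP frame of `s` and `(z, y)` an r.s.p. of `R` (`d + l = 3`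
  parameters) READING THE CENTRE: `C_{x_n}·B = ((z) + (X))/(h)` (`d = 3`: the closed point; `d = 2`: a curve `V(X, z₀, z₁)` as in
  res-type-067's `IsCPFrameAlong`; `d = 1`: a surface), with `h` EQUIMULTIPLE along it: `coeff_i h ∈ (z)^{m−i}` (`δ_J ≥ 1`; for `d = 3` this is
  `δ ≥ 1`). THEN `s'` carries a CP frame `(R', u', h', φ')` with `deg h' = deg h = m` and `coeff_i h' ∈ 𝔪_{R'}^{m−i}`, over a COMPLETE base `R'`
  (`IsAdicComplete (maximalIdeal R') R'`, kept for re-preparation at the next centre).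
  Chain: G2 (chart presentation of `𝒪_{x'}`, flat glue) → G6 (b) (a `z_{j₀}`-chart, monic transform over `S = R[(z)/z_{j₀}]`, prime `𝔔₃` over
  `𝔪_R`) → G6 (a) (`S_𝔮` regular) → G5 (ii-c) (nearness ⇒ order `m` persists ⇒ near shape ⇒ local frame over `S_𝔮` with `δ ≥ 1`) → G5 (ii-d)
  (completion + Hironaka's vertex preparation, res-lit-4). What is NOT here: the EXISTENCE of an adapted equimultiple reading `(z, y)` of a
  permissible centre in a given CP frame (CP 2019 Prop. 2.5/2.6: permissibility ⇔ `δ_J ≥ 1` after preparation) — a separate item.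
* `IsCPFrame.exists_isCPFrame_of_canonicalNearStep_of_forall_map_stalkIdeal_eq` — the same keyed to `CanonicalNearStep R₀ 3 ν s s'` with the
  reading hypothesis for every canonical centre at `s` (functional oracles have one).

References: CJS LNM 2270 Thm. 2.3, §2.2 [CossartJannsenSaito2020]; CP 2019 Prop. 2.2–2.6, (2.7) [CossartPiltant2019]; Matsumura Thms. 8.14, 15.1,
19.5 [Matsumura1987]; de Jong 1996, 2.4 [DeJong1996].
-/

noncomputable section

set_option linter.dupNamespace false

open CategoryTheory AlgebraicGeometry TopologicalSpace IsLocalRing Polynomial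
open Literature.AlgebraicGeometry.Resolution Literature.RingTheory.HilbertSamuel
open Summit.ResolutionOfSingularities.ResolutionOfSingularities.Theorems.CampaignW42
open Summit.ResolutionOfSingularities.ResolutionOfSingularities.Theorems.SigmaMaxModificationsCorridor3.Helpers

namespace Summit.ResolutionOfSingularities.ResolutionOfSingularities.Theorems.SigmaMaxModificationsCorridor3.Moving

/-- [OURS · L1 W4.2] **D18 (i), adapted equimultiple centres of any dimension (explicit step form): CP frames propagate to near points.**
See the module docstring. [cite: CossartJannsenSaito2020, Thm. 2.3 and §2.2] [cite: CossartPiltant2019, Prop. 2.2–2.6, (2.7) (arXiv v1 pp. 11–14)] -/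
theorem IsCPFrame.exists_isCPFrame_blowup_of_map_stalkIdeal_eq {p : ℕ} {R₀ : ∀ S : Scheme.{0}, CentreSeq S → Prop}
    (hRf : OracleFunctional R₀) (hRa : OracleAdmissible R₀) {ν : ℕ → ℕ} {X₀ : Scheme.{0}} [IsLocallyNoetherian X₀] {x : X₀}
    (hX : IsMaximalOrigin p 3 ν X₀ x) {s : MarkedStage.{0}} (hs : Reaches R₀ 3 ν (MarkedStage.init X₀ x) s)
    (C : s.W.IdealSheafData) (P' : Option (Pending (blowup C))) (hln' : IsLocallyNoetherian (blowup C)) (x' : ↥(blowup C))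
    (hcs : IsCanonicalStep R₀ 3 ν s.L s.P C P') (hx' : (blowup.π C).base x' = s.pt) (hcl : IsClosed ({x'} : Set ↥(blowup C)))
    (hstr : x' ∈ Scheme.hsStratum (blowup C) 3 ν)
    {R : Type} [CommRing R] [IsLocalRing R] {u : Fin 3 → R} {h : R[X]}
    {φ : (s.W.presheaf.stalk s.pt : Type) →+* R[X] ⧸ Ideal.span {h}} (hF : IsCPFrame s R u h φ)
    {d l : ℕ} (hdl : d + l = 3) (z : Fin d → R) (y : Fin l → R)
    (hzy : Ideal.span (Set.range (Fin.append z y)) = maximalIdeal R)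
    (hJ : (stalkIdeal C s.pt).map φ =
      ((Ideal.span (Set.range z)).map (Polynomial.C : R →+* R[X]) ⊔ Ideal.span {X}).map (Ideal.Quotient.mk (Ideal.span {h})))
    (hcoJ : ∀ i < h.natDegree, h.coeff i ∈ Ideal.span (Set.range z) ^ (h.natDegree - i)) :
    ∃ (R' : Type) (_ : CommRing R') (_ : IsLocalRing R') (u' : Fin 3 → R') (h' : R'[X])
      (φ' : ((blowup C).presheaf.stalk x' : Type) →+* R'[X] ⧸ Ideal.span {h'}),
      IsCPFrame ⟨blowup C, hln', s.L.next (Scheme.hsStratum s.W 3 ν) C, P', x'⟩ R' u' h' φ' ∧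
        IsAdicComplete (maximalIdeal R') R' ∧ h'.natDegree = h.natDegree ∧
      ∀ i < h'.natDegree, h'.coeff i ∈ maximalIdeal R' ^ (h'.natDegree - i) := by
  have hstep : CanonicalNearStep R₀ 3 ν s ⟨blowup C, hln', s.L.next (Scheme.hsStratum s.W 3 ν) C, P', x'⟩ :=
    ⟨C, P', hln', x', hcs, hx', hcl, hstr, rfl⟩
  have hm : 0 < h.natDegree := hF.natDegree_pos
  have hH := hilbertFun_stalk_eq_of_canonicalNearStep hRf hRa hX hs hstep
  have hd := ringKrullDim_stalk_eq_of_canonicalNearStep hRf hRa hX hs hstep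
  have hF' := hF
  obtain ⟨hR, hloc, hdim, hu, hmon, hφl, hflat, hmap, hsurj, hmin⟩ := hF'
  haveI := hR
  haveI := hloc
  haveI : IsLocalRing (AdjoinRoot h) := hloc
  haveI : IsLocallyNoetherian s.W := s.ln
  haveI : IsLocallyNoetherian (blowup C) := hln'
  have hdim3 : ringKrullDim R = ((d + l : ℕ) : WithBot ℕ∞) := by rw [hdl]; exact hdim
  have hzle : Ideal.span (Set.range z) ≤ maximalIdeal R := by
    rw [← hzy]
    exact Ideal.span_mono (Set.range_subset_iff.mpr fun j => ⟨Fin.castAdd l j, Fin.append_left z y j⟩)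
  have hco : ∀ i < h.natDegree, h.coeff i ∈ maximalIdeal R ^ (h.natDegree - i) := fun i hi =>
    Ideal.pow_right_mono hzle _ (hcoJ i hi)
  -- G2: the presentation of `𝒪_{x'}` on a chart algebra of `B = R[X]/(h)`
  obtain ⟨k, c, j, 𝔔', h𝔔'p, ψ', hc, h1, h2, h3, h4, h5, _⟩ := hF.exists_chart_presentation C x' hx'
  haveI := h𝔔'p
  have hg : φ (c j) ∈ (stalkIdeal C s.pt).map φ := Ideal.mem_map_of_mem φ (hc ▸ Ideal.subset_span ⟨j, rfl⟩)
  -- G6 (b): the monic transform over `S = R[(z)/z_{j₀}]`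
  obtain ⟨j₀, h', 𝔔₃, h𝔔₃p, ψ₃, hmon', hdeg', -, h𝔮, hflat₃, hloc₃, hmap₃, hres₃⟩ :=
    exists_adjoinRoot_chart_presentation_along hdim3 z y hzy hmon hcoJ ((stalkIdeal C s.pt).map φ) hJ hg 𝔔' h1 ψ' h2 h3 h4 h5
  haveI := h𝔔₃p
  -- G6 (a): the new base `S_𝔮` is regular; `S` is a Noetherian domain
  haveI : ((𝔔₃.comap (AdjoinRoot.mk h')).comap Polynomial.C).IsPrime := Ideal.comap_isPrime _ _
  haveI : IsDomain R := isDomain_of_isRegularLocalRing R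
  have hrsop : IsRsopPart z := ⟨inferInstance, l, y, hdim3, by rw [← range_fin_append, hzy]⟩
  have hprime := prime_algebraMap_blowupAlgebra_of_isRsopPart hrsop j₀
  have hz0 : z j₀ ≠ 0 := fun h0 => hprime.ne_zero (by rw [h0, map_zero])
  haveI : IsDomain (Localization.Away (z j₀)) :=
    IsLocalization.isDomain_localization (powers_le_nonZeroDivisors_of_noZeroDivisors hz0)
  haveI : IsDomain (blowupAlgebra (Ideal.span (Set.range z)) (z j₀)) := Subalgebra.isDomain _
  haveI : IsNoetherianRing (blowupAlgebra (Ideal.span (Set.range z)) (z j₀)) :=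
    isNoetherianRing_blowupAlgebra_of_isNoetherianRing _ _
  have hreg : IsRegularLocalRing (Localization.AtPrime ((𝔔₃.comap (AdjoinRoot.mk h')).comap Polynomial.C)) :=
    isRegularLocalRing_localization_blowupAlgebra_of_comap_eq_along hdim3 z y hzy j₀ _ h𝔮
  -- nearness in Hilbert–Samuel form, read on `B`
  letI algφ : Algebra (s.W.presheaf.stalk s.pt : Type) (R[X] ⧸ Ideal.span {h}) := φ.toAlgebra
  haveI : Module.Flat (s.W.presheaf.stalk s.pt : Type) (R[X] ⧸ Ideal.span {h}) := hflat
  haveI : IsLocalHom (algebraMap (s.W.presheaf.stalk s.pt : Type) (R[X] ⧸ Ideal.span {h})) := hφl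
  have hHB : hilbertFun (R[X] ⧸ Ideal.span {h}) = hilbertFun (s.W.presheaf.stalk s.pt : Type) :=
    hilbertFun_eq_of_flat_of_map_maximalIdeal_eq (A := (s.W.presheaf.stalk s.pt : Type)) (B := R[X] ⧸ Ideal.span {h}) hmap
  have hdB : ringKrullDim (R[X] ⧸ Ideal.span {h}) = ringKrullDim (s.W.presheaf.stalk s.pt : Type) :=
    Literature.AlgebraicGeometry.Resolution.ringKrullDim_eq_of_flat_of_map_maximalIdeal_eq (s.W.presheaf.stalk s.pt : Type)
      (R[X] ⧸ Ideal.span {h}) hmap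
  have hHO : hilbertFun ((blowup C).presheaf.stalk x' : Type) = hilbertFun (AdjoinRoot h) := hH.trans hHB.symm
  have hdO : ringKrullDim ((blowup C).presheaf.stalk x' : Type) = ringKrullDim (AdjoinRoot h) := hd.trans hdB.symm
  -- G5 (ii-c): the frame over `S_𝔮`
  obtain ⟨θ', hloc₁, φ₁, hdimS, hmo₁, hdeg₁, hco₁, hf₁, hl₁, hm₁, hr₁⟩ :=
    exists_local_frame_of_chart_presentation hmon hm hco _ hreg hmon' hdeg' 𝔔₃ rfl ψ₃ hflat₃ hloc₃ hmap₃ hres₃ hHO hdO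
  haveI := hloc₁
  -- G5 (ii-d): completion and vertex preparation
  have hm₁' : 0 < ((h'.map (algebraMap _ (Localization.AtPrime ((𝔔₃.comap (AdjoinRoot.mk h')).comap Polynomial.C)))).comp
      (X + Polynomial.C θ')).natDegree := by
    rw [hdeg₁]; exact hm
  have hdim3' : ringKrullDim (Localization.AtPrime ((𝔔₃.comap (AdjoinRoot.mk h')).comap Polynomial.C)) = (3 : ℕ) := by
    rw [hdimS, hdim3, hdl]
  obtain ⟨R', _, hreg', u', h₂, hloc₂, φ₂, hcpl, hdim', hu', hmon₂, hdeg₂, hco₂, hl₂, hf₂, hm₂, hr₂, hmin₂⟩ :=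
    exists_complete_minimal_frame hdim3' hmo₁ hm₁' (fun i hi => by
      rw [hdeg₁] at hi ⊢; exact hco₁ i hi) φ₁ hl₁ hf₁ hm₁ hr₁
  haveI := hreg'
  exact ⟨R', inferInstance, inferInstance, u', h₂, φ₂, ⟨hreg', hloc₂, hdim', hu', hmon₂, hl₂, hf₂, hm₂, hr₂, hmin₂⟩,
    hcpl, hdeg₂.trans hdeg₁, hco₂⟩

/-- [OURS · L1 W4.2] **D18 (i), adapted equimultiple centres (canonical-near-step form).** As `exists_isCPFrame_blowup_of_map_stalkIdeal_eq`, keyed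
to `CanonicalNearStep R₀ 3 ν s s'`, with the centre reading assumed for every canonical centre at `s` (a functional oracle has exactly one).
[cite: CossartJannsenSaito2020, Thm. 2.3 and §2.2] [cite: CossartPiltant2019, Prop. 2.2–2.6, (2.7) (arXiv v1 pp. 11–14)] -/
theorem IsCPFrame.exists_isCPFrame_of_canonicalNearStep_of_forall_map_stalkIdeal_eq {p : ℕ} {R₀ : ∀ S : Scheme.{0}, CentreSeq S → Prop}
    (hRf : OracleFunctional R₀) (hRa : OracleAdmissible R₀) {ν : ℕ → ℕ} {X₀ : Scheme.{0}} [IsLocallyNoetherian X₀] {x : X₀}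
    (hX : IsMaximalOrigin p 3 ν X₀ x) {s s' : MarkedStage.{0}} (hs : Reaches R₀ 3 ν (MarkedStage.init X₀ x) s)
    (hstep : CanonicalNearStep R₀ 3 ν s s')
    {R : Type} [CommRing R] [IsLocalRing R] {u : Fin 3 → R} {h : R[X]}
    {φ : (s.W.presheaf.stalk s.pt : Type) →+* R[X] ⧸ Ideal.span {h}} (hF : IsCPFrame s R u h φ)
    {d l : ℕ} (hdl : d + l = 3) (z : Fin d → R) (y : Fin l → R)
    (hzy : Ideal.span (Set.range (Fin.append z y)) = maximalIdeal R)
    (hJ : ∀ (C : s.W.IdealSheafData) (P' : Option (Pending (blowup C))), IsCanonicalStep R₀ 3 ν s.L s.P C P' →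
      (stalkIdeal C s.pt).map φ =
        ((Ideal.span (Set.range z)).map (Polynomial.C : R →+* R[X]) ⊔ Ideal.span {X}).map (Ideal.Quotient.mk (Ideal.span {h})))
    (hcoJ : ∀ i < h.natDegree, h.coeff i ∈ Ideal.span (Set.range z) ^ (h.natDegree - i)) :
    ∃ (R' : Type) (_ : CommRing R') (_ : IsLocalRing R') (u' : Fin 3 → R') (h' : R'[X])
      (φ' : (s'.W.presheaf.stalk s'.pt : Type) →+* R'[X] ⧸ Ideal.span {h'}),
      IsCPFrame s' R' u' h' φ' ∧ IsAdicComplete (maximalIdeal R') R' ∧ h'.natDegree = h.natDegree ∧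
      ∀ i < h'.natDegree, h'.coeff i ∈ maximalIdeal R' ^ (h'.natDegree - i) := by
  obtain ⟨C, P', hln', x', hcs, hx', hcl, hstr, rfl⟩ := hstep
  exact hF.exists_isCPFrame_blowup_of_map_stalkIdeal_eq hRf hRa hX hs C P' hln' x' hcs hx' hcl hstr hdl z y hzy (hJ C P' hcs) hcoJ

end Summit.ResolutionOfSingularities.ResolutionOfSingularities.Theorems.SigmaMaxModificationsCorridor3.Moving

end
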